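import Mathlib
import Literature.Analysis.FluidPDE.VectorCalculus
import Literature.Analysis.FluidPDE.NSWave0

/-!
# Support item `SlabEnergyIdentity` (stmt-NavierStokesRegularity-16859), route PlaneEnergyCeiling:
  the pointwise local energy identity and decay bookkeeping

Helper file for the slab energy identity
`Summit.NavierStokesRegularity.NavierStokesRegularity.Theses.PlaneEnergyCeiling.SlabEnergyIdentity`.
For smooth `u : ℝ³ → ℝ³`, `p : ℝ³ → ℝ` and the coordinate vectors `eⱼ = EuclideanSpace.single j 1`:

* `fderiv_inner_fderiv_apply`, `sum_fderiv_inner_fderiv` — `∂ᵥ⟪u, ∂ᵥu⟫ = ‖∂ᵥu‖² + ⟪u, D²u(v,v)⟫`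
  and `Σⱼ ∂ⱼ⟪u, ∂ⱼu⟫ = Σⱼ ‖∂ⱼu‖² + ⟪u, Δu⟫` (so `2⟪u, Δu⟫ = Δ|u|² − 2|∇u|²`);
* `fderiv_bernoulli_mul_apply`, `sum_fderiv_bernoulli_mul` — for divergence-free `u`,
  `Σⱼ ∂ⱼ((|u|²/2 + p) uⱼ) = ⟪u, (u·∇)u⟫ + ⟪u, ∇p⟫` (the Bernoulli flux is the divergence form of
  the convection and pressure work);
* `two_mul_inner_acc` — the pointwise local energy identity
  `2⟪u, νΔu − (u·∇)u − ∇p⟫ = 2ν Σⱼ ∂ⱼ⟪u, ∂ⱼu⟫ − 2ν Σⱼ ‖∂ⱼu‖² − 2 Σⱼ ∂ⱼ((|u|²/2 + p) uⱼ)`;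
* `exists_decay_constant` — from `HasRapidSpatialDecay` of `u` and `p`, one constant `C ≥ 1` with
  `‖u‖, ‖Du‖, ‖D²u‖, |p|, ‖Dp‖ ≤ C (1 + ‖x‖)⁻⁴`, and the resulting weighted bounds on the three
  densities above (`norm_inner_fderiv_le`, …), which feed the slab divergence theorem.

Folklore vector calculus (Caffarelli–Kohn–Nirenberg 1982 §2; Lemarié-Rieusset 2016, Ch. 13: the
local energy balance), here as pointwise identities for smooth fields; Mathlib + the tree's
`VectorCalculus` vocabulary (`convect`, `VectorCalculus.IsDivFree`, `divergence_eq_sum_inner_fderiv`).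
-/

noncomputable section

-- Problem = summit for this single-conjunct summit: the duplicate namespace component is deliberate.
set_option linter.dupNamespace false

namespace Summit.NavierStokesRegularity.NavierStokesRegularity.Theorems.PlaneEnergyCeilingSlabEnergyIdentity

open MeasureTheory Set Filter Topology WithLp
open scoped RealInnerProductSpace
open Literature.Analysis.FluidPDE

/-! ### Linear algebra of the coordinate frame -/

/-- Expansion in the coordinate frame: `Σⱼ vⱼ eⱼ = v`. -/
theorem sum_smul_single_eq (v : EuclideanSpace ℝ (Fin 3)) : ∑ j : Fin 3, v j • EuclideanSpace.single j (1 : ℝ) = v := by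
  ext k
  fin_cases k <;> simp [Fin.sum_univ_three]

/-- A linear functional against the frame: `Σⱼ Λ(eⱼ) vⱼ = Λ v`. -/
theorem sum_apply_single_mul (Λ : EuclideanSpace ℝ (Fin 3) →L[ℝ] ℝ) (v : EuclideanSpace ℝ (Fin 3)) :
    ∑ j : Fin 3, Λ (EuclideanSpace.single j 1) * v j = Λ v := by
  conv_rhs => rw [← sum_smul_single_eq v, map_sum]
  refine Finset.sum_congr rfl fun j _ => ?_
  rw [map_smul, smul_eq_mul, mul_comm]

/-- The divergence in the coordinate frame: `div u = Σⱼ (∂ⱼu)ⱼ`. -/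
theorem divergence_eq_sum_fderiv_apply (u : EuclideanSpace ℝ (Fin 3) → EuclideanSpace ℝ (Fin 3)) (x : EuclideanSpace ℝ (Fin 3)) :
    VectorCalculus.divergence u x = ∑ j : Fin 3, fderiv ℝ u x (EuclideanSpace.single j 1) j := by
  rw [divergence_eq_sum_inner_fderiv (EuclideanSpace.basisFun (Fin 3) ℝ)]
  refine Finset.sum_congr rfl fun j _ => ?_
  rw [EuclideanSpace.basisFun_apply, EuclideanSpace.inner_single_left]
  simp

/-- The Laplacian in the coordinate frame: `Δu = Σⱼ D²u(eⱼ,eⱼ)`. -/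
theorem laplacian_eq_sum_single (u : EuclideanSpace ℝ (Fin 3) → EuclideanSpace ℝ (Fin 3)) (x : EuclideanSpace ℝ (Fin 3)) :
    Laplacian.laplacian u x =
      ∑ j : Fin 3, iteratedFDeriv ℝ 2 u x ![EuclideanSpace.single j 1, EuclideanSpace.single j 1] := by
  rw [InnerProductSpace.laplacian_eq_iteratedFDeriv_orthonormalBasis u
    (EuclideanSpace.basisFun (Fin 3) ℝ)]
  simp only [EuclideanSpace.basisFun_apply]

/-! ### Derivatives of the energy densities -/

section Densities

variable {u : EuclideanSpace ℝ (Fin 3) → EuclideanSpace ℝ (Fin 3)} {p : EuclideanSpace ℝ (Fin 3) → ℝ}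

/-- The pure second directional derivative is the second Fréchet derivative on the diagonal:
`∂ᵥ(∂ᵥu) = D²u(v,v)` for `C²` fields. -/
theorem fderiv_fderiv_apply_eq_iteratedFDeriv (hu : ContDiff ℝ 2 u) (x v : EuclideanSpace ℝ (Fin 3)) :
    fderiv ℝ (fun y => fderiv ℝ u y v) x v = iteratedFDeriv ℝ 2 u x ![v, v] := by
  have hd : DifferentiableAt ℝ (fderiv ℝ u) x :=
    ((hu.fderiv_right (m := 1) le_rfl).differentiable one_ne_zero) x
  rw [iteratedFDeriv_two_apply, fderiv_clm_apply hd (differentiableAt_const v)]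
  simp

/-- `∂ᵥ⟪u, ∂ᵥu⟫ = ‖∂ᵥu‖² + ⟪u, D²u(v,v)⟫` for `C²` fields. -/
theorem fderiv_inner_fderiv_apply (hu : ContDiff ℝ 2 u) (x v : EuclideanSpace ℝ (Fin 3)) :
    fderiv ℝ (fun z => ⟪u z, fderiv ℝ u z v⟫) x v =
      ‖fderiv ℝ u x v‖ ^ 2 + ⟪u x, iteratedFDeriv ℝ 2 u x ![v, v]⟫ := by
  have h1 : DifferentiableAt ℝ u x := (hu.differentiable two_ne_zero) x
  have h2 : DifferentiableAt ℝ (fun y => fderiv ℝ u y v) x :=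
    (((hu.fderiv_right (m := 1) le_rfl).clm_apply contDiff_const).differentiable one_ne_zero) x
  rw [fderiv_inner_apply ℝ h1 h2, fderiv_fderiv_apply_eq_iteratedFDeriv hu, real_inner_comm,
    real_inner_self_eq_norm_sq, add_comm]

/-- `Σⱼ ∂ⱼ⟪u, ∂ⱼu⟫ = Σⱼ ‖∂ⱼu‖² + ⟪u, Δu⟫`, i.e. `Δ(|u|²/2) = |∇u|² + ⟪u, Δu⟫`, for `C²` fields. -/
theorem sum_fderiv_inner_fderiv (hu : ContDiff ℝ 2 u) (x : EuclideanSpace ℝ (Fin 3)) :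
    ∑ j : Fin 3, fderiv ℝ (fun z => ⟪u z, fderiv ℝ u z (EuclideanSpace.single j 1)⟫) x
        (EuclideanSpace.single j 1) =
      ∑ j : Fin 3, ‖fderiv ℝ u x (EuclideanSpace.single j 1)‖ ^ 2 + ⟪u x, Laplacian.laplacian u x⟫ := by
  simp_rw [fderiv_inner_fderiv_apply hu, Finset.sum_add_distrib, laplacian_eq_sum_single u x,
    inner_sum]

/-- The derivative of a coordinate of a field: `∂ᵥ(uⱼ) = (∂ᵥu)ⱼ`. -/
theorem hasFDerivAt_apply_coord (hu : Differentiable ℝ u) (x : EuclideanSpace ℝ (Fin 3)) (j : Fin 3) :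
    HasFDerivAt (fun z => u z j) ((PiLp.proj 2 (fun _ : Fin 3 => ℝ) j).comp (fderiv ℝ u x)) x := by
  have h := (PiLp.hasFDerivAt_apply 2 (u x) j).comp x (hu x).hasFDerivAt
  exact h

/-- The Bernoulli density `|u|²/2 + p` as `|u|² · 2⁻¹ + p` (the form the product rule yields). -/
theorem bernoulli_eq_mul_inv (u : EuclideanSpace ℝ (Fin 3) → EuclideanSpace ℝ (Fin 3)) (p : EuclideanSpace ℝ (Fin 3) → ℝ) :
    (fun z => ‖u z‖ ^ 2 / 2 + p z) = fun z => ‖u z‖ ^ 2 * 2⁻¹ + p z := by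
  funext z
  rw [div_eq_mul_inv]

/-- The Bernoulli density `|u|²/2 + p` is differentiable. -/
theorem differentiableAt_bernoulli (hu : Differentiable ℝ u) (hp : Differentiable ℝ p) (x : EuclideanSpace ℝ (Fin 3)) :
    DifferentiableAt ℝ (fun z => ‖u z‖ ^ 2 / 2 + p z) x := by
  rw [bernoulli_eq_mul_inv]
  exact (((hu x).hasFDerivAt.norm_sq.mul_const (2 : ℝ)⁻¹).add (hp x).hasFDerivAt).differentiableAt

/-- Applied form of the derivative of the Bernoulli density: `∂ᵥ(|u|²/2 + p) = ⟪u, ∂ᵥu⟫ + ∂ᵥp`. -/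
theorem fderiv_bernoulli_apply (hu : Differentiable ℝ u) (hp : Differentiable ℝ p) (x v : EuclideanSpace ℝ (Fin 3)) :
    fderiv ℝ (fun z => ‖u z‖ ^ 2 / 2 + p z) x v = ⟪u x, fderiv ℝ u x v⟫ + fderiv ℝ p x v := by
  rw [bernoulli_eq_mul_inv,
    (((hu x).hasFDerivAt.norm_sq.mul_const (2 : ℝ)⁻¹).fun_add (hp x).hasFDerivAt).fderiv]
  simp only [add_apply, smul_apply, ContinuousLinearMap.comp_apply, innerSL_apply_apply, smul_eq_mul,
    nsmul_eq_mul, Nat.cast_ofNat]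
  ring

/-- `∂ᵥ((|u|²/2 + p) uⱼ) = (⟪u, ∂ᵥu⟫ + ∂ᵥp) uⱼ + (|u|²/2 + p) (∂ᵥu)ⱼ` (Leibniz). -/
theorem fderiv_bernoulli_mul_apply (hu : Differentiable ℝ u) (hp : Differentiable ℝ p)
    (x v : EuclideanSpace ℝ (Fin 3)) (j : Fin 3) :
    fderiv ℝ (fun z => (‖u z‖ ^ 2 / 2 + p z) * u z j) x v =
      (⟪u x, fderiv ℝ u x v⟫ + fderiv ℝ p x v) * u x j +
        (‖u x‖ ^ 2 / 2 + p x) * fderiv ℝ u x v j := by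
  have hθ : DifferentiableAt ℝ (fun z => ‖u z‖ ^ 2 / 2 + p z) x := differentiableAt_bernoulli hu hp x
  have hj : DifferentiableAt ℝ (fun z => u z j) x := (hasFDerivAt_apply_coord hu x j).differentiableAt
  rw [fderiv_fun_mul hθ hj]
  simp only [add_apply, smul_apply, smul_eq_mul, fderiv_bernoulli_apply hu hp,
    (hasFDerivAt_apply_coord hu x j).fderiv, ContinuousLinearMap.comp_apply, PiLp.proj_apply]
  ring

/-- **The Bernoulli flux is a divergence form.** For differentiable divergence-free `u` and
differentiable `p`: `Σⱼ ∂ⱼ((|u|²/2 + p) uⱼ) = ⟪u, (u·∇)u⟫ + ⟪u, ∇p⟫`. -/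
theorem sum_fderiv_bernoulli_mul (hu : Differentiable ℝ u) (hp : Differentiable ℝ p)
    (hdiv : VectorCalculus.IsDivFree u) (x : EuclideanSpace ℝ (Fin 3)) :
    ∑ j : Fin 3, fderiv ℝ (fun z => (‖u z‖ ^ 2 / 2 + p z) * u z j) x (EuclideanSpace.single j 1) =
      ⟪u x, convect u u x⟫ + ⟪u x, gradient p x⟫ := by
  simp_rw [fderiv_bernoulli_mul_apply hu hp, Finset.sum_add_distrib, ← Finset.mul_sum,
    ← divergence_eq_sum_fderiv_apply u x, hdiv x, mul_zero, add_zero]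
  have key := sum_apply_single_mul ((innerSL ℝ (u x)).comp (fderiv ℝ u x) + fderiv ℝ p x) (u x)
  simp only [add_apply, ContinuousLinearMap.comp_apply, innerSL_apply_apply] at key
  rw [key, convect, gradient,
    ← real_inner_comm (u x) ((InnerProductSpace.toDual ℝ (EuclideanSpace ℝ (Fin 3))).symm (fderiv ℝ p x)),
    InnerProductSpace.toDual_symm_apply]

/-- **The pointwise local energy identity.** For `C²` divergence-free `u` and differentiable `p`,
with `acc = νΔu − (u·∇)u − ∇p`:
`2⟪u, acc⟫ = 2ν Σⱼ ∂ⱼ⟪u, ∂ⱼu⟫ − 2ν Σⱼ ‖∂ⱼu‖² − 2 Σⱼ ∂ⱼ((|u|²/2 + p) uⱼ)`. -/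
theorem two_mul_inner_acc (hu : ContDiff ℝ 2 u) (hp : Differentiable ℝ p)
    (hdiv : VectorCalculus.IsDivFree u) (ν : ℝ) (x : EuclideanSpace ℝ (Fin 3)) :
    2 * ⟪u x, ν • Laplacian.laplacian u x - convect u u x - gradient p x⟫ =
      2 * ν * ∑ j : Fin 3, fderiv ℝ (fun z => ⟪u z, fderiv ℝ u z (EuclideanSpace.single j 1)⟫) x
          (EuclideanSpace.single j 1) -
        2 * ν * ∑ j : Fin 3, ‖fderiv ℝ u x (EuclideanSpace.single j 1)‖ ^ 2 -
        2 * ∑ j : Fin 3, fderiv ℝ (fun z => (‖u z‖ ^ 2 / 2 + p z) * u z j) x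
          (EuclideanSpace.single j 1) := by
  rw [sum_fderiv_inner_fderiv hu, sum_fderiv_bernoulli_mul (hu.differentiable two_ne_zero) hp hdiv,
    inner_sub_right, inner_sub_right, real_inner_smul_right]
  ring

end Densities

/-! ### Decay bookkeeping -/

section Decay

variable {F : Type*} [NormedAddCommGroup F] [NormedSpace ℝ F]

/-- From `HasRapidSpatialDecay`: `‖Dⁿ w x‖ ≤ C (1 + ‖x‖)⁻⁴` with `C ≥ 0` (the defining bound with
`K = 4`, rewritten with a real power). -/
theorem norm_iteratedFDeriv_le_weight {w : EuclideanSpace ℝ (Fin 3) → F} (h : HasRapidSpatialDecay w) (n : ℕ) :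
    ∃ C, 0 ≤ C ∧ ∀ x, ‖iteratedFDeriv ℝ n w x‖ ≤ C * (1 + ‖x‖) ^ (-(4 : ℝ)) := by
  obtain ⟨C, hC⟩ := h n 4
  refine ⟨max C 0, le_max_right _ _, fun x => ?_⟩
  have hx : 0 < (1 + ‖x‖) ^ (4 : ℕ) := by positivity
  have h1 : ‖iteratedFDeriv ℝ n w x‖ ≤ C / (1 + ‖x‖) ^ (4 : ℕ) := by
    rw [le_div_iff₀ hx, mul_comm]; exact hC x
  have h2 : (1 + ‖x‖) ^ (-(4 : ℝ)) = ((1 + ‖x‖) ^ (4 : ℕ))⁻¹ := by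
    rw [Real.rpow_neg (by positivity), show (4 : ℝ) = ((4 : ℕ) : ℝ) by norm_num, Real.rpow_natCast]
  rw [h2, ← div_eq_mul_inv]
  exact h1.trans (div_le_div_of_nonneg_right (le_max_left _ _) hx.le)

/-- **One decay constant.** From rapid decay of `u` and `p`: a single `C ≥ 1` with
`‖u‖, ‖Du‖, ‖D²u‖, ‖p‖, ‖Dp‖ ≤ C (1 + ‖x‖)⁻⁴` everywhere. -/
theorem exists_decay_constant {u : EuclideanSpace ℝ (Fin 3) → EuclideanSpace ℝ (Fin 3)} {p : EuclideanSpace ℝ (Fin 3) → ℝ} (hdu : HasRapidSpatialDecay u)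
    (hdp : HasRapidSpatialDecay p) :
    ∃ C, 1 ≤ C ∧ (∀ x, ‖u x‖ ≤ C * (1 + ‖x‖) ^ (-(4 : ℝ))) ∧
      (∀ x, ‖fderiv ℝ u x‖ ≤ C * (1 + ‖x‖) ^ (-(4 : ℝ))) ∧
      (∀ x, ‖iteratedFDeriv ℝ 2 u x‖ ≤ C * (1 + ‖x‖) ^ (-(4 : ℝ))) ∧
      (∀ x, ‖p x‖ ≤ C * (1 + ‖x‖) ^ (-(4 : ℝ))) ∧
      (∀ x, ‖fderiv ℝ p x‖ ≤ C * (1 + ‖x‖) ^ (-(4 : ℝ))) := by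
  obtain ⟨C₀, h₀, hC₀⟩ := norm_iteratedFDeriv_le_weight hdu 0
  obtain ⟨C₁, h₁, hC₁⟩ := norm_iteratedFDeriv_le_weight hdu 1
  obtain ⟨C₂, h₂, hC₂⟩ := norm_iteratedFDeriv_le_weight hdu 2
  obtain ⟨D₀, k₀, hD₀⟩ := norm_iteratedFDeriv_le_weight hdp 0
  obtain ⟨D₁, k₁, hD₁⟩ := norm_iteratedFDeriv_le_weight hdp 1
  refine ⟨1 + C₀ + C₁ + C₂ + D₀ + D₁, by linarith, fun x => ?_, fun x => ?_, fun x => ?_,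
    fun x => ?_, fun x => ?_⟩
  · have := hC₀ x
    rw [norm_iteratedFDeriv_zero] at this
    exact this.trans (by gcongr; linarith)
  · have := hC₁ x
    rw [norm_iteratedFDeriv_one] at this
    exact this.trans (by gcongr; linarith)
  · exact (hC₂ x).trans (by gcongr; linarith)
  · have := hD₀ x
    rw [norm_iteratedFDeriv_zero] at this
    exact this.trans (by gcongr; linarith)
  · have := hD₁ x
    rw [norm_iteratedFDeriv_one] at this
    exact this.trans (by gcongr; linarith)

/-- Monotonicity of the model bounds `Cᵐ w` in the exponent, for `C ≥ 1`, `w ≥ 0`. -/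
theorem pow_mul_weight_mono {C w : ℝ} (hC : 1 ≤ C) (hw : 0 ≤ w) {m n : ℕ} (hmn : m ≤ n) :
    C ^ m * w ≤ C ^ n * w :=
  mul_le_mul_of_nonneg_right (pow_le_pow_right₀ hC hmn) hw

/-- A bound `b ≤ B w` with `w ≤ 1`, `B ≥ 0` gives `b ≤ B`. -/
theorem le_of_le_mul_weight {b B w : ℝ} (h : b ≤ B * w) (hB : 0 ≤ B) (hw1 : w ≤ 1) : b ≤ B :=
  h.trans (mul_le_of_le_one_right hB hw1)

/-- Products: `a ≤ A w`, `b ≤ B`, `a, b ≥ 0` give `a b ≤ A B w`. -/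
theorem mul_le_mul_weight {a b A B w : ℝ} (ha : 0 ≤ a) (hb : 0 ≤ b) (haA : a ≤ A * w) (hbB : b ≤ B) :
    a * b ≤ A * B * w := by
  calc a * b ≤ A * w * B := mul_le_mul haA hbB hb (ha.trans haA)
    _ = A * B * w := by ring

variable {u : EuclideanSpace ℝ (Fin 3) → EuclideanSpace ℝ (Fin 3)} {p : EuclideanSpace ℝ (Fin 3) → ℝ} {C w : ℝ} {x : EuclideanSpace ℝ (Fin 3)}

/-- A directional derivative along a coordinate vector is bounded by the full derivative:
`‖Du eⱼ‖ ≤ ‖Du‖`. -/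
theorem norm_fderiv_single_le (u : EuclideanSpace ℝ (Fin 3) → EuclideanSpace ℝ (Fin 3)) (x : EuclideanSpace ℝ (Fin 3)) (j : Fin 3) :
    ‖fderiv ℝ u x (EuclideanSpace.single j 1)‖ ≤ ‖fderiv ℝ u x‖ := by
  calc ‖fderiv ℝ u x (EuclideanSpace.single j 1)‖
      ≤ ‖fderiv ℝ u x‖ * ‖(EuclideanSpace.single j (1 : ℝ) : EuclideanSpace ℝ (Fin 3))‖ := ContinuousLinearMap.le_opNorm _ _
    _ = ‖fderiv ℝ u x‖ := by simp

/-- The diagonal second derivative along a coordinate vector is bounded by the full second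
derivative: `‖D²u(eⱼ,eⱼ)‖ ≤ ‖D²u‖`. -/
theorem norm_iteratedFDeriv_two_single_le (u : EuclideanSpace ℝ (Fin 3) → EuclideanSpace ℝ (Fin 3)) (x : EuclideanSpace ℝ (Fin 3)) (j : Fin 3) :
    ‖iteratedFDeriv ℝ 2 u x ![EuclideanSpace.single j 1, EuclideanSpace.single j 1]‖ ≤
      ‖iteratedFDeriv ℝ 2 u x‖ := by
  calc ‖iteratedFDeriv ℝ 2 u x ![EuclideanSpace.single j 1, EuclideanSpace.single j 1]‖
      ≤ ‖iteratedFDeriv ℝ 2 u x‖ * ∏ i, ‖(![EuclideanSpace.single j 1, EuclideanSpace.single j 1] :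
          Fin 2 → EuclideanSpace ℝ (Fin 3)) i‖ := ContinuousMultilinearMap.le_opNorm _ _
    _ = ‖iteratedFDeriv ℝ 2 u x‖ := by simp [Fin.prod_univ_two]

/-- Weighted bound on the density `⟪u, ∂ⱼu⟫`: `|⟪u, ∂ⱼu⟫| ≤ 4C³ w`. -/
theorem norm_inner_fderiv_le (hC : 1 ≤ C) (hw : 0 ≤ w) (hw1 : w ≤ 1) (h0 : ‖u x‖ ≤ C * w)
    (h1 : ‖fderiv ℝ u x‖ ≤ C * w) (j : Fin 3) :
    ‖⟪u x, fderiv ℝ u x (EuclideanSpace.single j 1)⟫‖ ≤ 4 * C ^ 3 * w := by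
  have hC0 : 0 ≤ C := by linarith
  have hb : ‖fderiv ℝ u x (EuclideanSpace.single j 1)‖ ≤ C :=
    (norm_fderiv_single_le u x j).trans (le_of_le_mul_weight h1 hC0 hw1)
  calc ‖⟪u x, fderiv ℝ u x (EuclideanSpace.single j 1)⟫‖
      ≤ ‖u x‖ * ‖fderiv ℝ u x (EuclideanSpace.single j 1)‖ := norm_inner_le_norm _ _
    _ ≤ C * C * w := mul_le_mul_weight (norm_nonneg _) (norm_nonneg _) h0 hb
    _ = C ^ 2 * w := by ring
    _ ≤ C ^ 3 * w := pow_mul_weight_mono hC hw (by norm_num)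
    _ ≤ 4 * C ^ 3 * w := by nlinarith [mul_nonneg (pow_nonneg hC0 3) hw]

/-- Weighted bound on `∂ⱼ⟪u, ∂ⱼu⟫ = ‖∂ⱼu‖² + ⟪u, D²u(eⱼ,eⱼ)⟫`: at most `4C³ w`. -/
theorem norm_fderiv_inner_fderiv_le (hC : 1 ≤ C) (hw : 0 ≤ w) (hw1 : w ≤ 1) (h0 : ‖u x‖ ≤ C * w)
    (h1 : ‖fderiv ℝ u x‖ ≤ C * w) (h2 : ‖iteratedFDeriv ℝ 2 u x‖ ≤ C * w) (j : Fin 3) :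
    ‖‖fderiv ℝ u x (EuclideanSpace.single j 1)‖ ^ 2 +
        ⟪u x, iteratedFDeriv ℝ 2 u x ![EuclideanSpace.single j 1, EuclideanSpace.single j 1]⟫‖ ≤
      4 * C ^ 3 * w := by
  have hC0 : 0 ≤ C := by linarith
  have ha : ‖fderiv ℝ u x (EuclideanSpace.single j 1)‖ ≤ C * w := (norm_fderiv_single_le u x j).trans h1
  have hb : ‖fderiv ℝ u x (EuclideanSpace.single j 1)‖ ≤ C := le_of_le_mul_weight ha hC0 hw1
  have hsq : ‖fderiv ℝ u x (EuclideanSpace.single j 1)‖ ^ 2 ≤ C * C * w := by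
    rw [sq]; exact mul_le_mul_weight (norm_nonneg _) (norm_nonneg _) ha hb
  have hin : ‖⟪u x, iteratedFDeriv ℝ 2 u x ![EuclideanSpace.single j 1, EuclideanSpace.single j 1]⟫‖
      ≤ C * C * w :=
    (norm_inner_le_norm _ _).trans (mul_le_mul_weight (norm_nonneg _) (norm_nonneg _) h0
      ((norm_iteratedFDeriv_two_single_le u x j).trans (le_of_le_mul_weight h2 hC0 hw1)))
  have h23 : C ^ 2 * w ≤ C ^ 3 * w := pow_mul_weight_mono hC hw (by norm_num)
  calc _ ≤ ‖‖fderiv ℝ u x (EuclideanSpace.single j 1)‖ ^ 2‖ +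
        ‖⟪u x, iteratedFDeriv ℝ 2 u x ![EuclideanSpace.single j 1, EuclideanSpace.single j 1]⟫‖ :=
        norm_add_le _ _
    _ ≤ C * C * w + C * C * w := by
        gcongr
        rwa [Real.norm_of_nonneg (sq_nonneg _)]
    _ = 2 * (C ^ 2 * w) := by ring
    _ ≤ 4 * C ^ 3 * w := by nlinarith [mul_nonneg (pow_nonneg hC0 3) hw]

/-- Weighted bound on the dissipation density `‖∂ⱼu‖²`: at most `4C³ w`. -/
theorem norm_sq_fderiv_le (hC : 1 ≤ C) (hw : 0 ≤ w) (hw1 : w ≤ 1) (h1 : ‖fderiv ℝ u x‖ ≤ C * w)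
    (j : Fin 3) : ‖‖fderiv ℝ u x (EuclideanSpace.single j 1)‖ ^ 2‖ ≤ 4 * C ^ 3 * w := by
  have hC0 : 0 ≤ C := by linarith
  have ha : ‖fderiv ℝ u x (EuclideanSpace.single j 1)‖ ≤ C * w := (norm_fderiv_single_le u x j).trans h1
  have hb : ‖fderiv ℝ u x (EuclideanSpace.single j 1)‖ ≤ C := le_of_le_mul_weight ha hC0 hw1
  rw [Real.norm_of_nonneg (sq_nonneg _), sq]
  calc _ ≤ C * C * w := mul_le_mul_weight (norm_nonneg _) (norm_nonneg _) ha hb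
    _ = C ^ 2 * w := by ring
    _ ≤ C ^ 3 * w := pow_mul_weight_mono hC hw (by norm_num)
    _ ≤ 4 * C ^ 3 * w := by nlinarith [mul_nonneg (pow_nonneg hC0 3) hw]

/-- A coordinate is bounded by the norm: `|vⱼ| ≤ ‖v‖`. -/
theorem norm_apply_le_norm (v : EuclideanSpace ℝ (Fin 3)) (j : Fin 3) : ‖v j‖ ≤ ‖v‖ := by
  have h := EuclideanSpace.inner_single_left j (1 : ℝ) v
  simp only [map_one, one_mul] at h
  rw [← h]
  calc ‖⟪EuclideanSpace.single j (1 : ℝ), v⟫‖ ≤ ‖(EuclideanSpace.single j (1 : ℝ) : EuclideanSpace ℝ (Fin 3))‖ * ‖v‖ :=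
        norm_inner_le_norm _ _
    _ = ‖v‖ := by simp

/-- Bound on the Bernoulli density: `|‖u‖²/2 + p| ≤ 2C²` (crudely). -/
theorem norm_bernoulli_le (hC : 1 ≤ C) (hw1 : w ≤ 1) (h0 : ‖u x‖ ≤ C * w)
    (k0 : ‖p x‖ ≤ C * w) : ‖‖u x‖ ^ 2 / 2 + p x‖ ≤ 2 * C ^ 2 := by
  have hC0 : 0 ≤ C := by linarith
  have hu : ‖u x‖ ≤ C := le_of_le_mul_weight h0 hC0 hw1
  have hp : ‖p x‖ ≤ C := le_of_le_mul_weight k0 hC0 hw1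
  have hsq : ‖u x‖ ^ 2 ≤ C ^ 2 := pow_le_pow_left₀ (norm_nonneg _) hu 2
  calc ‖‖u x‖ ^ 2 / 2 + p x‖ ≤ ‖‖u x‖ ^ 2 / 2‖ + ‖p x‖ := norm_add_le _ _
    _ = ‖u x‖ ^ 2 / 2 + ‖p x‖ := by rw [Real.norm_of_nonneg (by positivity)]
    _ ≤ C ^ 2 / 2 + C := by gcongr
    _ ≤ 2 * C ^ 2 := by nlinarith

/-- Weighted bound on the Bernoulli flux density `(‖u‖²/2 + p) uⱼ`: at most `4C³ w`. -/
theorem norm_bernoulli_mul_le (hC : 1 ≤ C) (hw : 0 ≤ w) (hw1 : w ≤ 1) (h0 : ‖u x‖ ≤ C * w)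
    (k0 : ‖p x‖ ≤ C * w) (j : Fin 3) :
    ‖(‖u x‖ ^ 2 / 2 + p x) * u x j‖ ≤ 4 * C ^ 3 * w := by
  have hC0 : 0 ≤ C := by linarith
  have hθ := norm_bernoulli_le hC hw1 h0 k0
  have huj : ‖u x j‖ ≤ C * w := (norm_apply_le_norm (u x) j).trans h0
  rw [norm_mul, mul_comm]
  calc ‖u x j‖ * ‖‖u x‖ ^ 2 / 2 + p x‖ ≤ C * (2 * C ^ 2) * w :=
        mul_le_mul_weight (norm_nonneg _) (norm_nonneg _) huj hθ
    _ = 2 * C ^ 3 * w := by ring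
    _ ≤ 4 * C ^ 3 * w := by nlinarith [mul_nonneg (pow_nonneg hC0 3) hw]

/-- Weighted bound on `∂ⱼ((‖u‖²/2 + p) uⱼ) = (⟪u, ∂ⱼu⟫ + ∂ⱼp) uⱼ + (‖u‖²/2 + p)(∂ⱼu)ⱼ`: at most
`4C³ w`. -/
theorem norm_fderiv_bernoulli_mul_le (hC : 1 ≤ C) (hw1 : w ≤ 1) (h0 : ‖u x‖ ≤ C * w)
    (h1 : ‖fderiv ℝ u x‖ ≤ C * w) (k0 : ‖p x‖ ≤ C * w) (k1 : ‖fderiv ℝ p x‖ ≤ C * w) (j : Fin 3) :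
    ‖(⟪u x, fderiv ℝ u x (EuclideanSpace.single j 1)⟫ + fderiv ℝ p x (EuclideanSpace.single j 1)) *
          u x j + (‖u x‖ ^ 2 / 2 + p x) * fderiv ℝ u x (EuclideanSpace.single j 1) j‖ ≤
      4 * C ^ 3 * w := by
  have hC0 : 0 ≤ C := by linarith
  have hu : ‖u x‖ ≤ C := le_of_le_mul_weight h0 hC0 hw1
  have hDu : ‖fderiv ℝ u x (EuclideanSpace.single j 1)‖ ≤ C * w := (norm_fderiv_single_le u x j).trans h1
  have hDu' : ‖fderiv ℝ u x (EuclideanSpace.single j 1)‖ ≤ C := le_of_le_mul_weight hDu hC0 hw1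
  have hDp : ‖fderiv ℝ p x (EuclideanSpace.single j 1)‖ ≤ C := by
    refine le_of_le_mul_weight ((ContinuousLinearMap.le_opNorm _ _).trans ?_) hC0 hw1
    simpa using k1
  -- first factor `⟪u, ∂ⱼu⟫ + ∂ⱼp` is bounded by `2C²`
  have hA : ‖⟪u x, fderiv ℝ u x (EuclideanSpace.single j 1)⟫ +
      fderiv ℝ p x (EuclideanSpace.single j 1)‖ ≤ 2 * C ^ 2 := by
    calc _ ≤ ‖⟪u x, fderiv ℝ u x (EuclideanSpace.single j 1)⟫‖ +
          ‖fderiv ℝ p x (EuclideanSpace.single j 1)‖ := norm_add_le _ _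
      _ ≤ ‖u x‖ * ‖fderiv ℝ u x (EuclideanSpace.single j 1)‖ + C := by
          gcongr; exact norm_inner_le_norm _ _
      _ ≤ C * C + C := by gcongr
      _ ≤ 2 * C ^ 2 := by nlinarith
  have huj : ‖u x j‖ ≤ C * w := (norm_apply_le_norm (u x) j).trans h0
  have hDuj : ‖fderiv ℝ u x (EuclideanSpace.single j 1) j‖ ≤ C * w :=
    (norm_apply_le_norm _ j).trans hDu
  have hθ := norm_bernoulli_le hC hw1 h0 k0
  calc _ ≤ ‖(⟪u x, fderiv ℝ u x (EuclideanSpace.single j 1)⟫ +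
          fderiv ℝ p x (EuclideanSpace.single j 1)) * u x j‖ +
        ‖(‖u x‖ ^ 2 / 2 + p x) * fderiv ℝ u x (EuclideanSpace.single j 1) j‖ := norm_add_le _ _
    _ = ‖u x j‖ * ‖⟪u x, fderiv ℝ u x (EuclideanSpace.single j 1)⟫ +
          fderiv ℝ p x (EuclideanSpace.single j 1)‖ +
        ‖fderiv ℝ u x (EuclideanSpace.single j 1) j‖ * ‖‖u x‖ ^ 2 / 2 + p x‖ := by
        rw [norm_mul, norm_mul, mul_comm, mul_comm ‖‖u x‖ ^ 2 / 2 + p x‖]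
    _ ≤ C * (2 * C ^ 2) * w + C * (2 * C ^ 2) * w := by
        gcongr ?_ + ?_
        · exact mul_le_mul_weight (norm_nonneg _) (norm_nonneg _) huj hA
        · exact mul_le_mul_weight (norm_nonneg _) (norm_nonneg _) hDuj hθ
    _ = 4 * C ^ 3 * w := by ring

end Decay

end Summit.NavierStokesRegularity.NavierStokesRegularity.Theorems.PlaneEnergyCeilingSlabEnergyIdentity

end
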